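import Summits.QuantumFields.YangMills.Theorems.BalabanUVNodesPortS1FHInterface
import Summits.QuantumFields.BalabanUV.T4Continuum.Support.NE9Contraction113Banach
import Literature.MathematicalPhysics.QuantumFieldTheory.Balaban1983to89.B13Contraction113
import Literature.MathematicalPhysics.QuantumFieldTheory.Balaban1983to89.B12Lineariz267
open Metric Set Filter Topology

/-!
# (◆ CRIT-1 g41 REUSE-EDITION CANDIDATE of ◇ v26a Part I — §A∕§B replaced by a corollary of ✓`NE9Contraction113Banach.exists_analyticOnNhd_solution_113`;
# `hHop_of_norm_le`, `analyticAt_DT` keep ◇'s exported SIGNATURES, §C verbatim; for the CUT line only, not a filing.)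
-/

namespace Summit.QuantumFields.YangMills.Theorems.BalabanUVNodesPortS1.FHParam

open Literature.MathematicalPhysics.QuantumFieldTheory.Balaban1983to89
open Literature.MathematicalPhysics.QuantumFieldTheory.Balaban1983to89.B13Contraction113 (QuadAnalytic)
open Summit.QuantumFields.YangMills.Theorems.BalabanUVNodesPortS1.FHInterface
open Summit.QuantumFields.BalabanUV.T4Continuum.NE9Contraction113Banach (exists_analyticOnNhd_solution_113)

/-! ## §B′  The (1.3) fixed point `D` as an analytic functional of `(H, A′)` — COROLLARY of the tree's universal solution map -/

section fh1

variable {𝔄 𝔛 : Type*} [NormedAddCommGroup 𝔄] [NormedSpace ℂ 𝔄] [CompleteSpace 𝔄] [NormedAddCommGroup 𝔛] [NormedSpace ℂ 𝔛] [CompleteSpace 𝔛]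
  {C : 𝔄 → 𝔛} {C₂ R b ε : ℝ}

omit [CompleteSpace 𝔄] [CompleteSpace 𝔛] in
/-- Operator-norm form of the tree's hypothesis `‖hop X‖ ≤ b‖X‖` for `‖T‖ ≤ b`. [folklore] -/
theorem hHop_of_norm_le {T : 𝔛 →L[ℂ] 𝔄} (hT : ‖T‖ ≤ b) : ∀ X : 𝔛, ‖(T : 𝔛 →ₗ[ℂ] 𝔄) X‖ ≤ b * ‖X‖ := fun X =>
  (T.le_opNorm X).trans (mul_le_mul_of_nonneg_right hT (norm_nonneg _))

/-- **F_H-s, operator form: `(T, A′) ↦ D_T(A′)` is complex-ANALYTIC** at every `‖T₀‖ < b`, `‖A₀‖ < ε`, for ANY family of solutions of (1.3)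
in the closed ball `4C₂ε²` — by UNIQUENESS it agrees near `(T₀, A₀)` with the tree's universal solution map
✓`NE9Contraction113Banach.exists_analyticOnNhd_solution_113`, which is jointly analytic on `ball 0 ε ×ˢ ball 0 b`. [folklore]
[cite: Balaban1988RG2Cluster, p.3 L1–5, (1.13)–(1.14) p.5] -/
theorem analyticAt_DT (hC : QuadAnalytic C C₂ R) (hCa : AnalyticOnNhd ℂ C {Z : 𝔄 | ‖Z‖ < R}) (hC₂ : 0 ≤ C₂) (hb : 0 ≤ b)
    (hq : 9 * C₂ * b * ε < 1) (hRC : 3 * ε ≤ R) {D : (𝔛 →L[ℂ] 𝔄) → 𝔄 → 𝔛}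
    (hDball : ∀ T : 𝔛 →L[ℂ] 𝔄, ‖T‖ < b → ∀ A' : 𝔄, ‖A'‖ < ε → D T A' ∈ closedBall (0:𝔛) (4 * C₂ * ε ^ 2))
    (hDfix : ∀ T : 𝔛 →L[ℂ] 𝔄, ‖T‖ < b → ∀ A' : 𝔄, ‖A'‖ < ε → C (A' - T (D T A')) = D T A')
    {T₀ : 𝔛 →L[ℂ] 𝔄} (hT₀ : ‖T₀‖ < b) {A₀ : 𝔄} (hA₀ : ‖A₀‖ < ε) :
    AnalyticAt ℂ (fun p : (𝔛 →L[ℂ] 𝔄) × 𝔄 => D p.1 p.2) (T₀, A₀) := by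
  have hε : 0 < ε := lt_of_le_of_lt (norm_nonneg _) hA₀
  have hCa' : AnalyticOnNhd ℂ C (ball (0:𝔄) R) := fun Z hZ => hCa Z (by simpa using hZ)
  obtain ⟨Du, hDu, hcl, -⟩ := exists_analyticOnNhd_solution_113 (𝒳 := 𝔛) (𝒴 := 𝔄) hC.quad hCa' hC₂ hb hε hq hRC
  have hnear : ∀ᶠ p in 𝓝 ((T₀, A₀) : (𝔛 →L[ℂ] 𝔄) × 𝔄), ‖p.1‖ < b ∧ ‖p.2‖ < ε := by
    have h1 : IsOpen {p : (𝔛 →L[ℂ] 𝔄) × 𝔄 | ‖p.1‖ < b ∧ ‖p.2‖ < ε} :=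
      (isOpen_lt (continuous_fst.norm) continuous_const).inter (isOpen_lt (continuous_snd.norm) continuous_const)
    exact h1.mem_nhds ⟨hT₀, hA₀⟩
  have heq : (fun p : (𝔛 →L[ℂ] 𝔄) × 𝔄 => Du (p.2, p.1)) =ᶠ[𝓝 (T₀, A₀)] (fun p => D p.1 p.2) := by
    filter_upwards [hnear] with p hp
    have hin : (p.2, p.1) ∈ ball (0:𝔄) ε ×ˢ ball (0 : 𝔛 →L[ℂ] 𝔄) b := ⟨mem_ball_zero_iff.mpr hp.2, mem_ball_zero_iff.mpr hp.1⟩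
    exact ((hcl _ hin).2.2.1 (D p.1 p.2) (hDball p.1 hp.1 p.2 hp.2) (hDfix p.1 hp.1 p.2 hp.2)).symm
  have han : AnalyticAt ℂ (fun p : (𝔛 →L[ℂ] 𝔄) × 𝔄 => Du (p.2, p.1)) (T₀, A₀) :=
    (hDu _ ⟨mem_ball_zero_iff.mpr hA₀, mem_ball_zero_iff.mpr hT₀⟩).comp₂ analyticAt_snd analyticAt_fst
  exact han.congr heq

end fh1

/-! ## §C  F_H-s for `D`: the s-COROLLARY over the (B-op) row of ✓`DecoupledOps.Bounds` (differentiability, no analyticity upgrade) -/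

section sparamD

variable {𝔄 𝔛 : Type*} [NormedAddCommGroup 𝔄] [NormedSpace ℂ 𝔄] [CompleteSpace 𝔄] [NormedAddCommGroup 𝔛] [NormedSpace ℂ 𝔛] [CompleteSpace 𝔛]
  {σ : Type*} [Fintype σ] {C : 𝔄 → 𝔛} {C₂ R b ε : ℝ} {Hs : (σ → ℂ) → (𝔛 →L[ℂ] 𝔄)} {U : Set (σ → ℂ)} {D : (σ → ℂ) → 𝔄 → 𝔛}

/-- **F_H-s (the `D` half): `(s, A′) ↦ D_s(A′)` is ℂ-differentiable on `U ×ˢ {‖A′‖ < ε}`** for ANY family `D s` of solutions of (1.3) with the operator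
`H(s)` (closed-ball + fixed-point properties at each `s ∈ U`), whenever `s ↦ H(s)` is ℂ-differentiable on `U` with `‖H(s)‖ ≤ b` there — exactly the
(B-op) row of ✓`DecoupledOps.Bounds` on `U = sPolydisc σ e^{κ₁}` — and `9C₂bε < 1`, `3ε ≤ R`.  Proof: enlarge `b` to `b′ > b` with `9C₂b′ε < 1`; the choice
family `D♯_T` on `‖T‖ < b′` (✓`B12Lineariz267.exists_Dt`) agrees with `D s` at `T = H(s)` (✓`Dt_unique`); `D♯` is analytic (`analyticAt_DT`), compose with
`q ↦ (H(q.1), q.2)`.  This is [II] p.5 L−3 «an analytic function of the variables s(Y₀)» for `D`, in the ONE currency the port's interface carries. [folklore]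
[cite: Balaban1988RG2Cluster, p.5 L−3–p.6 L1, p.3 L1–5] -/
theorem differentiableOn_D_sparam (hC : QuadAnalytic C C₂ R) (hCa : AnalyticOnNhd ℂ C {Z : 𝔄 | ‖Z‖ < R}) (hC₂ : 0 ≤ C₂) (hb : 0 ≤ b)
    (hq : 9 * C₂ * b * ε < 1) (hRC : 3 * ε ≤ R) (hHd : DifferentiableOn ℂ Hs U) (hHb : ∀ s ∈ U, ‖Hs s‖ ≤ b)
    (hDball : ∀ s ∈ U, ∀ A' : 𝔄, ‖A'‖ < ε → D s A' ∈ closedBall (0:𝔛) (4 * C₂ * ε ^ 2))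
    (hDfix : ∀ s ∈ U, ∀ A' : 𝔄, ‖A'‖ < ε → C (A' - Hs s (D s A')) = D s A') :
    DifferentiableOn ℂ (fun q : (σ → ℂ) × 𝔄 => D q.1 q.2) (U ×ˢ ball (0:𝔄) ε) := by
  classical
  obtain ⟨b', hbb', hq'⟩ : ∃ b', b < b' ∧ 9 * C₂ * b' * ε < 1 := by
    have hcont : ContinuousAt (fun t : ℝ => 9 * C₂ * t * ε) b := by fun_prop
    exact (hcont.eventually_lt continuousAt_const hq).exists_gt
  have hb' : 0 ≤ b' := hb.trans hbb'.le
  have hex : ∀ T : 𝔛 →L[ℂ] 𝔄, ‖T‖ < b' → ∃ Dt : 𝔄 → 𝔛, ∀ A' : 𝔄, ‖A'‖ < ε →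
      Dt A' ∈ closedBall (0:𝔛) (4 * C₂ * ε ^ 2) ∧ C (A' - (T : 𝔛 →ₗ[ℂ] 𝔄) (Dt A')) = Dt A' := fun T hT =>
    B12Lineariz267.exists_Dt (hop := (T : 𝔛 →ₗ[ℂ] 𝔄)) hC hC₂ hb' (hHop_of_norm_le hT.le) hq' hRC
  let Dsh : (𝔛 →L[ℂ] 𝔄) → 𝔄 → 𝔛 := fun T => if hT : ‖T‖ < b' then Classical.choose (hex T hT) else fun _ => 0
  have hDsh : ∀ T : 𝔛 →L[ℂ] 𝔄, ∀ hT : ‖T‖ < b', ∀ A' : 𝔄, ‖A'‖ < ε →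
      Dsh T A' ∈ closedBall (0:𝔛) (4 * C₂ * ε ^ 2) ∧ C (A' - T (Dsh T A')) = Dsh T A' := by
    intro T hT A' hA'
    simp only [Dsh, dif_pos hT]
    exact Classical.choose_spec (hex T hT) A' hA'
  have hident : ∀ q ∈ U ×ˢ ball (0:𝔄) ε, D q.1 q.2 = Dsh (Hs q.1) q.2 := by
    rintro ⟨s, A'⟩ ⟨hs, hA'⟩
    rw [mem_ball_zero_iff] at hA'
    have hT : ‖Hs s‖ < b' := (hHb s hs).trans_lt hbb'
    exact B12Lineariz267.Dt_unique (hop := ((Hs s : 𝔛 →L[ℂ] 𝔄) : 𝔛 →ₗ[ℂ] 𝔄)) hC hC₂ hb' (hHop_of_norm_le hT.le) hq' hRC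
      (fun B hB => hDball s hs B hB) (fun B hB => hDfix s hs B hB)
      (fun B hB => (hDsh _ hT B hB).1) (fun B hB => (hDsh _ hT B hB).2) hA'
  rintro ⟨s, A'⟩ ⟨hs, hA'⟩
  have hA'' : ‖A'‖ < ε := mem_ball_zero_iff.mp hA'
  have hT : ‖Hs s‖ < b' := (hHb s hs).trans_lt hbb'
  have han : AnalyticAt ℂ (fun p : (𝔛 →L[ℂ] 𝔄) × 𝔄 => Dsh p.1 p.2) (Hs s, A') :=
    analyticAt_DT hC hCa hC₂ hb' hq' hRC (fun T hT A' hA' => (hDsh T hT A' hA').1) (fun T hT A' hA' => (hDsh T hT A' hA').2) hT hA''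
  have hre : DifferentiableWithinAt ℂ (fun q : (σ → ℂ) × 𝔄 => (Hs q.1, q.2)) (U ×ˢ ball (0:𝔄) ε) (s, A') := by
    have h1 : DifferentiableWithinAt ℂ (fun q : (σ → ℂ) × 𝔄 => Hs q.1) (U ×ˢ ball (0:𝔄) ε) (s, A') :=
      (hHd s hs).comp (s, A') differentiableWithinAt_fst (fun q hqU => hqU.1)
    exact h1.prodMk differentiableWithinAt_snd
  have hcomp := han.differentiableAt.comp_differentiableWithinAt (s, A') hre
  exact hcomp.congr (fun q hq => hident q hq) (hident (s, A') ⟨hs, hA'⟩)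

end sparamD

end Summit.QuantumFields.YangMills.Theorems.BalabanUVNodesPortS1.FHParam
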